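import Summits.Ventures.PercRepro.C026HubPairDec

/-!
# Hub-pair graphs, V: the finite check of the rotation (p5, gen 11)

The rows of a supported graph on `n ∈ {4, 5}` vertices (marks `0, 1, 2`, non-marks `3, 4`, no
mark–mark edge) are determined by one bit per class `(m, x)`, `(3, 4)`: `pairRows k` (resp. `hubRows k`)
rebuilds the rows from the bits of `k` (`bitOfClass5`).  `chk n O C` states, for a `KL` source,
everything the injection argument needs of its image and of itself:

* the image is `bot`, has `o1 ∨ o2` and `BAD → o1 ∧ o2` (score `+1`);
* the decoder recovers the rotated set; a rotated vertex has no closed `c`-edge and no open `a`- or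
  `b`-edge; a cut pair is all-open iff the unrotated partner has a closed `c`-edge.

`chk5_q0 … chk5_q3` / `chk4_all` check it for every state by `decide +kernel` (the open bits `o`, the
closed bits `c`; a cheap necessary condition `botFast5` for `bot` — itself checked against `botB`
by `botFast5_of_botB` — prunes the non-`bot` states).
-/

namespace PercRepro

namespace PairModel

/-- The class bit of `(i, j)` on five vertices: classes `(0,3), (1,3), (2,3), (0,4), (1,4), (2,4),
(3,4)` are the bits `0, …, 6` of `k`; every other pair is absent. -/
def bitOfClass5 (k i j : ℕ) : Bool :=
  match i, j with
  | 0, 3 => k.testBit 0 | 3, 0 => k.testBit 0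
  | 1, 3 => k.testBit 1 | 3, 1 => k.testBit 1
  | 2, 3 => k.testBit 2 | 3, 2 => k.testBit 2
  | 0, 4 => k.testBit 3 | 4, 0 => k.testBit 3
  | 1, 4 => k.testBit 4 | 4, 1 => k.testBit 4
  | 2, 4 => k.testBit 5 | 4, 2 => k.testBit 5
  | 3, 4 => k.testBit 6 | 4, 3 => k.testBit 6
  | _, _ => false

/-- The rows on five vertices with the class bits of `k`. -/
def pairRows (k : ℕ) : Rows := (List.range 5).map fun i => maskOf 5 (bitOfClass5 k i)

/-- The class bit of `(i, j)` on four vertices: classes `(0,3), (1,3), (2,3)` are the bits `0, 1, 2`. -/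
def bitOfClass4 (k i j : ℕ) : Bool :=
  match i, j with
  | 0, 3 => k.testBit 0 | 3, 0 => k.testBit 0
  | 1, 3 => k.testBit 1 | 3, 1 => k.testBit 1
  | 2, 3 => k.testBit 2 | 3, 2 => k.testBit 2
  | _, _ => false

/-- The rows on four vertices with the class bits of `k`. -/
def hubRows (k : ℕ) : Rows := (List.range 4).map fun i => maskOf 4 (bitOfClass4 k i)

/-- A cheap necessary condition for `bot` on five vertices: each non-mark is attached to at most one
mark, and an open partner edge does not join two non-marks attached to different marks. -/
def botFast5 (o : ℕ) : Bool :=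
  let xa := o.testBit 0
  let xb := o.testBit 1
  let xc := o.testBit 2
  let ya := o.testBit 3
  let yb := o.testBit 4
  let yc := o.testBit 5
  let xy := o.testBit 6
  !(xa && xb) && !(xa && xc) && !(xb && xc) && !(ya && yb) && !(ya && yc) && !(yb && yc) &&
    !(xy && ((xa && (yb || yc)) || (xb && (ya || yc)) || (xc && (ya || yb))))

/-- A `KL` source: `bot`, `BAD`, neither `o1` nor `o2`. -/
def isKL (n : ℕ) (O C : Rows) : Bool := botB n O && badB n O C && !o1B n O C && !o2B n O C

/-- The facts about the image rows `O', C'` and the source rows `O, C` of a `KL` source. -/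
def chkImg (n : ℕ) (O C O' C' : Rows) : Bool :=
  botB n O' && (o1B n O' C' || o2B n O' C') && (!badB n O' C' || (o1B n O' C' && o2B n O' C')) &&
    ((List.range n).all fun i => rotD' n O' C' i == rot n O C i) &&
    ((List.range n).all fun i => !rot n O C i || (!adj C i 2 && !adj O i 0 && !adj O i 1)) &&
    ((List.range n).all fun p => (List.range n).all fun q =>
      !(nonMark p && nonMark q && (p != q) && rot n O C p && !rot n O C q) ||
        ((!adj C q 2 || !adj C p q) && (adj C q 2 || !adj O p q)))

/-- **The check** of a state: not a `KL` source, or `chkImg` holds for its image. -/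
def chk (n : ℕ) (O C : Rows) : Bool :=
  !isKL n O C || chkImg n O C (imgO n O C) (imgC n O C)

/-- The check on five vertices for the open bits `o` and the closed bits `c`, pruned by `botFast5`. -/
def chk5 (o c : ℕ) : Bool := !botFast5 o || chk 5 (pairRows o) (pairRows c)

/-- The check on four vertices. -/
def chk4 (o c : ℕ) : Bool := chk 4 (hubRows o) (hubRows c)

set_option maxRecDepth 100000 in
/-- `botFast5` is necessary for `bot`. -/
theorem botFast5_of_botB : ∀ o < 128, botB 5 (pairRows o) = true → botFast5 o = true := by
  decide +kernel

set_option maxRecDepth 100000 in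
/-- The pair gadget, closed bits `0 ≤ c < 32`. -/
theorem chk5_q0 : ∀ o < 128, ∀ c < 32, chk5 o c = true := by decide +kernel

set_option maxRecDepth 100000 in
/-- The pair gadget, closed bits `32 ≤ c < 64`. -/
theorem chk5_q1 : ∀ o < 128, ∀ c < 32, chk5 o (c + 32) = true := by decide +kernel

set_option maxRecDepth 100000 in
/-- The pair gadget, closed bits `64 ≤ c < 96`. -/
theorem chk5_q2 : ∀ o < 128, ∀ c < 32, chk5 o (c + 64) = true := by decide +kernel

set_option maxRecDepth 100000 in
/-- The pair gadget, closed bits `96 ≤ c < 128`. -/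
theorem chk5_q3 : ∀ o < 128, ∀ c < 32, chk5 o (c + 96) = true := by decide +kernel

/-- **The pair gadget: every state passes the check.** -/
theorem chk5_all : ∀ o < 128, ∀ c < 128, chk5 o c = true := by
  intro o ho c hc
  rcases Nat.lt_or_ge c 32 with h | h
  · exact chk5_q0 o ho c h
  rcases Nat.lt_or_ge c 64 with h' | h'
  · have := chk5_q1 o ho (c - 32) (by omega)
    rwa [Nat.sub_add_cancel h] at this
  rcases Nat.lt_or_ge c 96 with h'' | h''
  · have := chk5_q2 o ho (c - 64) (by omega)
    rwa [Nat.sub_add_cancel h'] at this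
  · have := chk5_q3 o ho (c - 96) (by omega)
    rwa [Nat.sub_add_cancel h''] at this

set_option maxRecDepth 100000 in
/-- **A single hub: every state passes the check.** -/
theorem chk4_all : ∀ o < 8, ∀ c < 8, chk4 o c = true := by decide +kernel

end PairModel

end PercRepro
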